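import Summits.QuantumFields.YangMills.Theorems.UnitScaleTiltProp8HalvingELJunction
import HarnessLib

/-!
# Route `UnitScaleTilt`, crux K1 child «MinimiserStabilityRegPr» (stmt-QuantumFields-19200), registered stub V2′ `stub_halvingStep`
# (skeletons v8 5b4e846794b80374 / v10 `BirthV10`) — **THE SLICE (153) IN MULTIPLIER FORM** (owner socket (σ-3), file 12 — the input side of `hslice`): [Balaban1985RegularSpaces]
# (1.38)/(1.42) `R(U₀)D^{η*}_{U₀}A = 0` is typed in the tree (lit-balaban `B8Eq138LandauZd.IsLandau138`, `B8Eq138Multiplier`) in LAGRANGE-MULTIPLIER FORM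
# «`Δ^η(D^{η*}A) = Q′ᵀμ` for some multiplier `μ` on the site index set» — no scalar product needed.  HERE the same equivalence for P2's `R` of the nested family
# ([Balaban1984PropagatorsII] (2.10)–(2.12): the orthogonal projection onto `ΔN(Q′)`): `R v = 0 ⟺ Δv ∈ range Q′*`, and its `𝔤`-valued reading: a MATRIX multiplier form
# `Δ(∂*A₁)(s) = Σ_i (Q′e_s)(i)·μ(i)` gives the reading-wise slice `R∂*(φ∘A₁) = 0` of `HalvingELJunction.flatStencil_eq_of_slice` ∕ `HalvingA1Row165EL.row165_of_slice` ∕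
# `HalvingA1Row165TraceL5.row165_of_tracePairing_L5(_anyW)` for EVERY `ℝ`-linear `φ`

Cell `ym3-torus` (HUMAN RULING D-0037, YM ladder rung R3 — continuum SU(2) YM₃ on the torus is a RUNG, not the Clay problem), width seat
`ym-ust-19200-w3` gen 3 (D-0149).  `--supports stmt-QuantumFields-19200 --as helper`; def-free, 0 sorry, standard axioms.

WHAT THIS FILE PROVES (no definition, no sorry; every `D : Domains P`, lattice factor `c`):
* `RE_eq_zero_of_lapE_eq_QpsE` (`Δv = Q′*μ ⇒ Rv = 0`), `exists_QpsE_of_RE_eq_zero` (`Rv = 0 ⇒ ∃ μ, Δv = Q′*μ`), `RE_eq_zero_iff_exists_QpsE`;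
* `QpsE_apply_eq_sum` (`(Q′*μ)(s) = Σ_i μ(i)·(Q′e_s)(i)`), `diverg_reading`, `laplace_reading` (the flat `∂*`, `Δ` commute with real readings of matrix fields);
* **`slice_of_matrixMultiplier`** (T³ carrier, every `D : Domains (F.P K)`): `(∃ μ : SiteIdx D → M₂(ℂ), ∀ s, Δ(∂*A₁)(s) = Σ_i (Q′_{j(i)}e_s)(i)•μ(i))` ⟹
  `∀ φ, RE D L^{K−n} (dsE L^{K−n} (toLp (φ∘A₁))) = 0`.
HONEST SCOPE.  Finite-dimensional algebra; the dictionary between [B8]'s `ℤᵈ`-carrier `Q′(U₀)`/`Δ^η_{U₀}` at `U₀ = 1` and P2's `Q′`/`Δ` of the cube sequence (the analogue of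
`HalvingQuarterMatrix.re_pdiv_plaqCovDeriv_pull` for sites) is P1's.  NOT a claim about the crux, the rung, or the mass gap.

References: T. Bałaban, CMP **99** (1985) 75–102 [Balaban1985RegularSpaces] (1.27) p.80, (1.38) p.82, (1.146) p.101; CMP **96** (1984) 223–250 [Balaban1984PropagatorsII]
(2.9)–(2.12) pp.224–225; CMP **102** (1985) 277–309 [Balaban1985Variational] (153) p.301.
-/

set_option autoImplicit false

noncomputable section

open scoped BigOperators InnerProductSpace Matrix Matrix.Norms.L2Operator

namespace Summit.QuantumFields.YangMills.Theorems.HalvingSliceMultiplier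

open Literature.MathematicalPhysics.QuantumFieldTheory.Balaban1983to89
open Literature.MathematicalPhysics.QuantumFieldTheory.BalabanImbrieJaffe1984to88.BIJ85AxialPropagator411 (BondSpace)
open B6SectADomainsV1 (Domains)
open B6SectAOperatorsV1 (SiteIdx SiteIdxSpace ScalarSpace QpE QpsE RE dsE dE lapE inner_eq_sum inner_QpsE_left RE_eq_zero_iff inner_lapE_right lapE_apply dsE_apply
  QpE_apply)
open LatticeFieldCalculus (laplace diverg siteAvgIter)
open T3ContinuumYM3Torus (T3Family)

/-! ## §1 `Rv = 0 ⟺ Δv ∈ range Q′*` (model level) -/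

section Model

variable {P : Params} (D : Domains P) (c : ℝ)

/-- `Δ` is symmetric: `⟨Δf, g⟩ = ⟨f, Δg⟩`. [cite: Balaban1984PropagatorsII, (2.8) p.224] -/
theorem inner_lapE_comm (f g : ScalarSpace P) : ⟪lapE c f, g⟫_ℝ = ⟪f, lapE c g⟫_ℝ := by
  rw [real_inner_comm, inner_lapE_right, inner_lapE_right, real_inner_comm]

/-- **`Δv = Q′*μ ⇒ Rv = 0`**: a Lagrange-multiplier form of the Landau condition implies the projection form ((2.12): `Rv = 0 ⟺ ⟨Δn, v⟩ = 0 ∀ n ∈ N(Q′)`,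
and `⟨Δn, v⟩ = ⟨n, Δv⟩ = ⟨Q′n, μ⟩ = 0`). [cite: Balaban1984PropagatorsII, (2.9)-(2.12) pp.224-225; Balaban1985RegularSpaces, (1.38) p.82] -/
theorem RE_eq_zero_of_lapE_eq_QpsE {v : ScalarSpace P} {μ : SiteIdxSpace D} (h : lapE c v = QpsE D μ) : RE D c v = 0 := by
  rw [RE_eq_zero_iff]
  intro n hn
  rw [inner_lapE_comm, h, real_inner_comm, inner_QpsE_left, LinearMap.mem_ker.1 hn, inner_zero_right]

/-- **`Rv = 0 ⇒ ∃ μ, Δv = Q′*μ`** (`(ker Q′)ᗮ = range Q′*` in finite dimension). [cite: Balaban1984PropagatorsII, (2.9)-(2.12) pp.224-225; Balaban1985RegularSpaces, (1.146) p.101] -/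
theorem exists_QpsE_of_RE_eq_zero {v : ScalarSpace P} (h : RE D c v = 0) : ∃ μ : SiteIdxSpace D, lapE c v = QpsE D μ := by
  rw [RE_eq_zero_iff] at h
  have hmem : lapE c v ∈ (LinearMap.ker (QpE D))ᗮ := by
    rw [Submodule.mem_orthogonal]
    intro n hn
    rw [← inner_lapE_comm, h n hn]
  rw [LinearMap.orthogonal_ker] at hmem
  obtain ⟨μ, hμ⟩ := LinearMap.mem_range.1 hmem
  exact ⟨μ, hμ.symm⟩

/-- `Rv = 0 ⟺ ∃ μ, Δv = Q′*μ`. [cite: Balaban1984PropagatorsII, (2.12) p.225; Balaban1985RegularSpaces, (1.38) p.82, (1.146) p.101] -/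
theorem RE_eq_zero_iff_exists_QpsE (v : ScalarSpace P) : RE D c v = 0 ↔ ∃ μ : SiteIdxSpace D, lapE c v = QpsE D μ :=
  ⟨exists_QpsE_of_RE_eq_zero D c, fun ⟨_, h⟩ => RE_eq_zero_of_lapE_eq_QpsE D c h⟩

/-- **`(Q′*μ)(s) = Σ_i μ(i)·(Q′e_s)(i)`** — the `ℓ²`-adjoint of the multi-scale `Q′` on the indicator of a site. [cite: Balaban1984PropagatorsII, (2.14)-(2.15) p.225] -/
theorem QpsE_apply_eq_sum (μ : SiteIdxSpace D) (s : Site P 0) :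
    QpsE D μ s = ∑ i : SiteIdx D, μ i * siteAvgIter (i.1.1 : ℕ) (Pi.single s (1 : ℝ)) i.1.2 := by
  have h := inner_QpsE_left (D := D) μ (EuclideanSpace.single s (1 : ℝ))
  rw [EuclideanSpace.inner_single_right] at h
  simp only [one_mul, conj_trivial] at h
  rw [h, inner_eq_sum]
  refine Finset.sum_congr rfl fun i _ => ?_
  rw [QpE_apply, PiLp.ofLp_single]

end Model

/-! ## §2 The `𝔤`-valued reading at the T³ carrier -/

section Carrier

variable {F : T3Family} {n K : ℕ}

/-- `∂*` commutes with real readings of matrix fields. [cite: Balaban1984PropagatorsII, (2.8) p.224] -/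
theorem diverg_reading (c : ℝ) (φ : Matrix (Fin 2) (Fin 2) ℂ →ₗ[ℝ] ℝ) (A : PBond (F.P K) 0 → Matrix (Fin 2) (Fin 2) ℂ) (s : Site (F.P K) 0) :
    diverg c (fun b => φ (A b)) s = φ (diverg c A s) := by
  simp only [diverg, map_sum, LinearMap.map_smul, map_sub, smul_eq_mul]

/-- `Δ` commutes with real readings of matrix fields. [cite: Balaban1984PropagatorsII, (2.8) p.224] -/
theorem laplace_reading (c : ℝ) (φ : Matrix (Fin 2) (Fin 2) ℂ →ₗ[ℝ] ℝ) (f : Site (F.P K) 0 → Matrix (Fin 2) (Fin 2) ℂ) (s : Site (F.P K) 0) :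
    laplace c (fun x => φ (f x)) s = φ (laplace c f s) := by
  simp only [laplace, map_sum, LinearMap.map_smul, map_sub, map_add, smul_eq_mul]

/-- **THE SLICE FROM A MATRIX MULTIPLIER FORM OF (153)**: if `Δ(∂*A₁)(s) = Σ_i (Q′_{j(i)}e_s)(i)•μ(i)` for some `𝔤`-valued multiplier `μ` on the site index set of `D`
(lattice factor `L^{K−n}`), then `R∂*(φ∘A₁) = 0` for every `ℝ`-linear reading `φ` — the `hslice` of `HalvingELJunction.flatStencil_eq_of_slice` and of the (165)-A₁ knits.
[cite: Balaban1985RegularSpaces, (1.38) p.82; Balaban1984PropagatorsII, (2.12) p.225; Balaban1985Variational, (153) p.301] -/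
theorem slice_of_matrixMultiplier (D : Domains (F.P K)) {A₁ : PBond (F.P K) 0 → Matrix (Fin 2) (Fin 2) ℂ}
    (hμ : ∃ μ : SiteIdx D → Matrix (Fin 2) (Fin 2) ℂ, ∀ s : Site (F.P K) 0,
      laplace ((F.L : ℝ) ^ (K - n)) (diverg ((F.L : ℝ) ^ (K - n)) A₁) s = ∑ i : SiteIdx D, siteAvgIter (i.1.1 : ℕ) (Pi.single s (1 : ℝ)) i.1.2 • μ i) :
    ∀ φ : Matrix (Fin 2) (Fin 2) ℂ →ₗ[ℝ] ℝ,
      RE D ((F.L : ℝ) ^ (K - n)) (dsE ((F.L : ℝ) ^ (K - n)) (WithLp.toLp 2 (fun b => φ (A₁ b)))) = 0 := by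
  intro φ
  obtain ⟨μ, hμ⟩ := hμ
  refine RE_eq_zero_of_lapE_eq_QpsE D _ (μ := WithLp.toLp 2 (fun i => φ (μ i))) ?_
  ext s
  rw [lapE_apply, QpsE_apply_eq_sum]
  have hds : WithLp.ofLp (dsE ((F.L : ℝ) ^ (K - n)) (WithLp.toLp 2 (fun b => φ (A₁ b)))) = fun x => φ (diverg ((F.L : ℝ) ^ (K - n)) A₁ x) := by
    funext x
    exact diverg_reading _ φ A₁ x
  rw [hds, laplace_reading, hμ s, map_sum]
  refine Finset.sum_congr rfl fun i _ => ?_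
  rw [LinearMap.map_smul, smul_eq_mul, mul_comm]

end Carrier

end Summit.QuantumFields.YangMills.Theorems.HalvingSliceMultiplier

end
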